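import Literature.NumberTheory.Rogawski1990.ArchChartOrbGSplitCompactProduct   -- ★ (A1) (LH5-p02 (g4)): `chartOrbG_eq_prod_mul_integral_pi`, `integrable_comp_symm_archPiEquivCM_descConj_pi_of_regG`
import Literature.NumberTheory.Automorphic.ArchInnerFormChartOrbLocal          -- ★ G1∕G2: `compactSpace_chartTorusGLoc_of_not_mem`, `chartBoxImgGLoc_eq_univ_of_not_mem`
import Literature.MeasureTheory.Group.InvariantQuotientCompactSubgroup           -- ★ `integral_quotientMeasure_eq_inv_smul` (compact subgroup: `μ_{G/H} = ρ(H)⁻¹ • π_* ν`)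
import HarnessLib

/-!
# `chartOrbG` with ONE place isolated: the global chart-orbital family is, at a compact place `w₀`, the whole-group orbital integral of the
# partial chart-orbital integral over the other places («(J-iso) ONE-PLACE ISOLATION» of ★ (A1); Folland 1995 §2.6 (2.52); Rogawski 1990 §8.2–8.3)

Topic `NumberTheory/Rogawski1990`; namespace `Literature.NumberTheory.Automorphic.UnitaryGroup`.  THEOREMS ONLY (no `def`, no instance, no notation, no axiom,
no named fact, no `sorry`).  Cell `pub/hodgecm-mathlib`, crux H413 (`stmt-HodgeConjecture-24833`), F0∕P3c line LH3 (closer stub `stub_N9`, DIRECT ROAD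
`F0_P3c_StubN9Direct`, LEAF v5), organ O-L1d «HC-CENTRAL ∕ SCALAR CORNERS», brick **(J-iso)** of F0P3a-p05 (g20)'s (B3-JUNCTION) plan (LH3-plan (g4) RULING #18,
2026-09-02; CALL BY NAME 10:59:06Z), seat F0P3a-p07 (g18).  Count-neutral measure-theoretic bookkeeping: nothing here closes an organ.

THE MATHEMATICS.  ★ (A1) `chartOrbG_eq_prod_mul_integral_pi` writes the normalised orbital-integral chart family `chartOrbG L α ν′ S′ a′ c` of `G′_∞ = U(diag α)(L⁺ ⊗ ℝ)
≃ Π_w U(α)_w` (admissible label `S′`, product-measure convention `ν′ = e⁻¹_* ⊗_w ν′_w`, any inversion-invariant Haar family `t_w` on the local chart tori `T′_{S′,w}`)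
as ONE integral over the product of the local quotients `Π_w (U(α)_w ⧸ T′_{S′,w})` against `⊗_w (ν′_w ∕ t_w)`.  Splitting the index set as `{w₀} ⊔ {w ≠ w₀}`
(Mathlib `MeasurableEquiv.piEquivPiSubtypeProd (· = w₀)` and `MeasurableEquiv.piUnique`, written INLINE exactly as in ★ `ArchTorusOrbitalFubini` §3 — no new definition)
and Fubini (the `Integrable` binder, discharged at every `c ∈ RegG S′` for `a′ ∈ C_c(G′_∞)` by ★ (A1) §4) give
* §1 **`chartOrbG_eq_prod_mul_integral_integral_isolate`** (binder form) ∕ **`…_isolate_of_regG`**: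
  `chartOrbG ν′ S′ a′ c = (Π_w t_w(B′_w)) · ∫_{U_{w₀} ⧸ T′_{w₀}} ( ∫_{Π_{w≠w₀} (U_w ⧸ T′_w)} a′ (e⁻¹ (z_w γ_w(c) z_w⁻¹)_w) d(⊗_{w≠w₀} ν′_w∕t_w) ) d(ν′_{w₀}∕t_{w₀})`
  — the `w₀`-variable OUTSIDE, all other places (split or compact) INSIDE;
* §2 **`chartOrbG_eq_prod_mul_integral_group_isolate_of_not_mem`** — at a COMPACT-chart place `w₀ ∉ S′` the local torus `T′_{S′,w₀}` is compact (★
  `compactSpace_chartTorusGLoc_of_not_mem`), the quotient integral is `t_{w₀}(T′)⁻¹ ∫_{U_{w₀}}` (★ `integral_quotientMeasure_eq_inv_smul`) and the box factor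
  `t_{w₀}(B′_{w₀}) = t_{w₀}(T′)` (★ `chartBoxImgGLoc_eq_univ_of_not_mem`) CANCELS:
  `chartOrbG ν′ S′ a′ c = (Π_{w≠w₀} t_w(B′_w)) · ∫_{U_{w₀}} Θ_c(g · γ_{w₀}(c) · g⁻¹) dν′_{w₀}(g)`,
  `Θ_c(x) = ∫_{Π_{w≠w₀} (U_w ⧸ T′_w)} a′ (e⁻¹ (x, (z_w γ_w(c) z_w⁻¹)_{w≠w₀})) d(⊗_{w≠w₀} ν′_w∕t_w)` — the `w₀`-place is a WHOLE-GROUP orbital integral of the partial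
  chart-orbital integral over the other places (the shape ★ `chartOrbGLoc_eq_integral_of_not_mem` has for a tensor factor), the other places being a smooth
  parameter of `Θ_c` (what (B3-JUNCTION) differentiates through ★ (A4′) `contDiffOn_smoothModel_prod_param`).
HONEST LABEL: HC_CM is proved only modulo the 7 printed citations (2 remaining: hLiu418 = `stmt-HodgeConjecture-24832`, h413 = `stmt-HodgeConjecture-24833`) until rung 0
closes; this file moves no row of the books.

## References
* [Folland1995] G. B. Folland, *A Course in Abstract Harmonic Analysis* (1995), §2.2 (product measures), §2.6 Thm. 2.49, (2.52) (quotient integral formula).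
* [Rogawski1990] J. D. Rogawski, *Automorphic Representations of Unitary Groups in Three Variables*, Ann. of Math. Stud. 123 (1990), §8.2 p. 122, §8.3 p. 124
  (orbital integrals on the regular set, place by place).
* [BorelJacquet1979] A. Borel, H. Jacquet, *Automorphic forms and automorphic representations*, PSPM 33.1 (1979), §4.1 (`G_∞ = Π_v G(F_v)`, product measures).
* [DeitmarEchterhoff2014] A. Deitmar, S. Echterhoff, *Principles of Harmonic Analysis*, 2nd ed. (2014), Thm. 1.5.3, Cor. 1.5.4, Lemma 9.3.3.
-/

set_option autoImplicit false

noncomputable section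

open MeasureTheory MeasureTheory.Measure NumberField NumberField.InfinitePlace Matrix Complex Topology
open Literature.MeasureTheory.Group Literature.NumberTheory.Rogawski1990
open scoped MatrixGroups Matrix Classical ENNReal NNReal

namespace Literature.NumberTheory.Automorphic.UnitaryGroup

section Isolate

variable (L : Type) [Field L] [NumberField L] [IsCMField L] (α : Fin 3 → L) (S' : Finset {w : InfinitePlace L // IsComplex w})
  [∀ w : {w : InfinitePlace L // IsComplex w}, MeasurableSpace ↥(archLocal L 3 (Matrix.diagonal α) w)]
  [∀ w : {w : InfinitePlace L // IsComplex w}, BorelSpace ↥(archLocal L 3 (Matrix.diagonal α) w)]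
  -- ★ `locallyCompactSpace_archLocal_three` ∕ ★ `secondCountableTopology_archLocal_three` (theorems, not instances: supplied by the consumer with `haveI`)
  [∀ w : {w : InfinitePlace L // IsComplex w}, LocallyCompactSpace ↥(archLocal L 3 (Matrix.diagonal α) w)]
  [∀ w : {w : InfinitePlace L // IsComplex w}, SecondCountableTopology ↥(archLocal L 3 (Matrix.diagonal α) w)]
  [MeasurableSpace ↥(arch (↥(maximalRealSubfield L)) L (IsCMField.complexConj L) 3 (Matrix.diagonal α))]
  [BorelSpace ↥(arch (↥(maximalRealSubfield L)) L (IsCMField.complexConj L) 3 (Matrix.diagonal α))]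
  [∀ w : {w : InfinitePlace L // IsComplex w}, MeasurableSpace (↥(archLocal L 3 (Matrix.diagonal α) w) ⧸ chartTorusGLoc L α w S')]
  [∀ w : {w : InfinitePlace L // IsComplex w}, BorelSpace (↥(archLocal L 3 (Matrix.diagonal α) w) ⧸ chartTorusGLoc L α w S')]
  (ν'w : ∀ w : {w : InfinitePlace L // IsComplex w}, Measure ↥(archLocal L 3 (Matrix.diagonal α) w)) [∀ w, (ν'w w).IsHaarMeasure] [∀ w, (ν'w w).IsMulRightInvariant]
  (ν' : Measure ↥(arch (↥(maximalRealSubfield L)) L (IsCMField.complexConj L) 3 (Matrix.diagonal α))) [ν'.IsHaarMeasure] [ν'.IsMulRightInvariant]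
  (hν : ν' = (Measure.pi ν'w).map (archPiEquivCM 3 L (Matrix.diagonal α)).symm)
  (t : ∀ w : {w : InfinitePlace L // IsComplex w}, Measure ↥(chartTorusGLoc L α w S')) [∀ w, (t w).IsHaarMeasure] [∀ w, (t w).IsInvInvariant]

/-! ## §1 The quotient form: the `w₀`-quotient OUTSIDE, every other place INSIDE (Fubini on ★ (A1) §1) -/

include hν in
/-- **(J-iso), BINDER FORM — ONE PLACE `w₀` ISOLATED** (Fubini on the all-places product form ★ `chartOrbG_eq_prod_mul_integral_pi`): under the `Integrable` binder of the
product-coordinates integrand (discharged at every `c ∈ RegG S′` for `a′ ∈ C_c(G′_∞)` in `…_isolate_of_regG`),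
`chartOrbG ν′ S′ a′ c = (Π_w t_w(B′_w)) · ∫_{U_{w₀}⧸T′_{w₀}} ( ∫_{Π_{w≠w₀}(U_w⧸T′_w)} a′ (e⁻¹ (z_w γ_w(c) z_w⁻¹)_w) d(⊗_{w≠w₀} ν′_w∕t_w) ) d(ν′_{w₀}∕t_{w₀})`, `γ_w(c) = gprimeBlockAt α w S′ (c w)`, the
family `z = (y, b)` assembled by Mathlib's `piEquivPiSubtypeProd (· = w₀)` and `piUnique` (the INLINE device of ★ `ArchTorusOrbitalFubini` §3; no new definition).
[cite: Folland1995, §2.6 (2.52)] [cite: Rogawski1990, §8.2 p. 122; §8.3 p. 124] [cite: BorelJacquet1979, §4.1] [cite: DeitmarEchterhoff2014, Lemma 9.3.3] -/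
theorem chartOrbG_eq_prod_mul_integral_integral_isolate (hα : ∀ i, α i ≠ 0) (hS' : ∀ w, w ∈ S' → w ∈ splitChartPlaces L α)
    (w₀ : {w : InfinitePlace L // IsComplex w})
    {a' : ↥(arch (↥(maximalRealSubfield L)) L (IsCMField.complexConj L) 3 (Matrix.diagonal α)) → ℂ}
    {c : {w : InfinitePlace L // IsComplex w} → Fin 3 → ℝ}
    (hint : Integrable (fun x : (∀ w : {w : InfinitePlace L // IsComplex w}, ↥(archLocal L 3 (Matrix.diagonal α) w) ⧸ chartTorusGLoc L α w S') =>
        a' ((archPiEquivCM 3 L (Matrix.diagonal α)).symm fun w =>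
          descConj (gprimeBlockAt L α w S' (c w)) (chartTorusGLoc L α w S') (forall_mem_chartTorusGLoc_comm L α w S' (c w)) id (x w)))
      (Measure.pi fun w => quotientMeasure (chartTorusGLoc L α w S') (t w) (isClosed_chartTorusGLoc L α w S') (ν'w w))) :
    chartOrbG L α ν' S' a' c =
      (∏ w, ((t w (chartBoxImgGLoc L α w S')).toReal : ℂ)) *
        ∫ y : ↥(archLocal L 3 (Matrix.diagonal α) w₀) ⧸ chartTorusGLoc L α w₀ S',
          (∫ b : (∀ w' : {w : {w : InfinitePlace L // IsComplex w} // ¬ w = w₀}, ↥(archLocal L 3 (Matrix.diagonal α) w'.1) ⧸ chartTorusGLoc L α w'.1 S'),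
            a' ((archPiEquivCM 3 L (Matrix.diagonal α)).symm fun w =>
              descConj (gprimeBlockAt L α w S' (c w)) (chartTorusGLoc L α w S') (forall_mem_chartTorusGLoc_comm L α w S' (c w)) id
                ((MeasurableEquiv.piEquivPiSubtypeProd
                    (fun w : {w : InfinitePlace L // IsComplex w} => ↥(archLocal L 3 (Matrix.diagonal α) w) ⧸ chartTorusGLoc L α w S') (· = w₀)).symm
                  ((MeasurableEquiv.piUnique fun i : {w : {w : InfinitePlace L // IsComplex w} // w = w₀} =>
                      ↥(archLocal L 3 (Matrix.diagonal α) i.1) ⧸ chartTorusGLoc L α i.1 S').symm y, b) w))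
            ∂(Measure.pi fun w' : {w : {w : InfinitePlace L // IsComplex w} // ¬ w = w₀} =>
                quotientMeasure (chartTorusGLoc L α w'.1 S') (t w'.1) (isClosed_chartTorusGLoc L α w'.1 S') (ν'w w'.1)))
          ∂(quotientMeasure (chartTorusGLoc L α w₀ S') (t w₀) (isClosed_chartTorusGLoc L α w₀ S') (ν'w w₀)) := by
  haveI : ∀ w : {w : InfinitePlace L // IsComplex w}, IsClosed (chartTorusGLoc L α w S' : Set ↥(archLocal L 3 (Matrix.diagonal α) w)) :=
    fun w => isClosed_chartTorusGLoc L α w S'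
  haveI : ∀ w : {w : InfinitePlace L // IsComplex w}, SecondCountableTopology (↥(archLocal L 3 (Matrix.diagonal α) w) ⧸ chartTorusGLoc L α w S') := fun w => inferInstance
  haveI : ∀ w : {w : InfinitePlace L // IsComplex w},
      SigmaFinite (quotientMeasure (chartTorusGLoc L α w S') (t w) (isClosed_chartTorusGLoc L α w S') (ν'w w)) := fun w => inferInstance
  rw [chartOrbG_eq_prod_mul_integral_pi L α S' ν'w ν' hν t hα hS' a' c]
  congr 1
  -- the integrand on `Π_w (U_w ⧸ T′_w)`
  set F : (∀ w : {w : InfinitePlace L // IsComplex w}, ↥(archLocal L 3 (Matrix.diagonal α) w) ⧸ chartTorusGLoc L α w S') → ℂ :=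
    fun x => a' ((archPiEquivCM 3 L (Matrix.diagonal α)).symm fun w =>
      descConj (gprimeBlockAt L α w S' (c w)) (chartTorusGLoc L α w S') (forall_mem_chartTorusGLoc_comm L α w S' (c w)) id (x w)) with hF
  -- split `Π_w Q_w ≃ (Π_{w = w₀} Q_w) × (Π_{w ≠ w₀} Q_w)` (measure preserving) and apply Fubini
  have hψ' := measurePreserving_piEquivPiSubtypeProd
    (fun w : {w : InfinitePlace L // IsComplex w} => quotientMeasure (chartTorusGLoc L α w S') (t w) (isClosed_chartTorusGLoc L α w S') (ν'w w)) (· = w₀)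
  have h2 := (hψ'.symm.integral_comp' F).symm
  have hFi' : Integrable (fun q => F ((MeasurableEquiv.piEquivPiSubtypeProd
      (fun w : {w : InfinitePlace L // IsComplex w} => ↥(archLocal L 3 (Matrix.diagonal α) w) ⧸ chartTorusGLoc L α w S') (· = w₀)).symm q)) _ :=
    (hψ'.symm.integrable_comp_emb (MeasurableEquiv.measurableEmbedding _)).mpr hint
  rw [show (∫ x, a' ((archPiEquivCM 3 L (Matrix.diagonal α)).symm fun w =>
      descConj (gprimeBlockAt L α w S' (c w)) (chartTorusGLoc L α w S') (forall_mem_chartTorusGLoc_comm L α w S' (c w)) id (x w))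
      ∂(Measure.pi fun w => quotientMeasure (chartTorusGLoc L α w S') (t w) (isClosed_chartTorusGLoc L α w S') (ν'w w))) =
      ∫ x, F x ∂(Measure.pi fun w => quotientMeasure (chartTorusGLoc L α w S') (t w) (isClosed_chartTorusGLoc L α w S') (ν'w w)) from rfl,
    h2, integral_prod _ hFi']
  -- the first factor `Π_{w = w₀} Q_w ≃ Q_{w₀}` (`piUnique`)
  have hu' : MeasurePreserving
      (MeasurableEquiv.piUnique fun i : {w : {w : InfinitePlace L // IsComplex w} // w = w₀} => ↥(archLocal L 3 (Matrix.diagonal α) i.1) ⧸ chartTorusGLoc L α i.1 S')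
      (@Measure.pi {w : {w : InfinitePlace L // IsComplex w} // w = w₀} (fun i => ↥(archLocal L 3 (Matrix.diagonal α) i.1) ⧸ chartTorusGLoc L α i.1 S')
        (Subtype.fintype fun x => x = w₀) (fun i => inferInstance)
        (fun i => quotientMeasure (chartTorusGLoc L α i.1 S') (t i.1) (isClosed_chartTorusGLoc L α i.1 S') (ν'w i.1)))
      (quotientMeasure (chartTorusGLoc L α w₀ S') (t w₀) (isClosed_chartTorusGLoc L α w₀ S') (ν'w w₀)) := by
    convert measurePreserving_piUnique
      (fun i : {w : {w : InfinitePlace L // IsComplex w} // w = w₀} =>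
        quotientMeasure (chartTorusGLoc L α i.1 S') (t i.1) (isClosed_chartTorusGLoc L α i.1 S') (ν'w i.1)) <;>
      exact ((default : {w : {w : InfinitePlace L // IsComplex w} // w = w₀}).2).symm
  rw [← hu'.symm.integral_comp']
  rfl

include hν in
/-- **(J-iso) AT A REGULAR POINT, BINDER-FREE**: for admissible `S′`, ANY place `w₀`, `c ∈ RegG S′` and `a′ ∈ C_c(G′_∞)`,
`chartOrbG ν′ S′ a′ c = (Π_w t_w(B′_w)) · ∫_{U_{w₀}⧸T′_{w₀}} ( ∫_{Π_{w≠w₀}(U_w⧸T′_w)} a′ (e⁻¹ (z_w γ_w(c) z_w⁻¹)_w) d(⊗_{w≠w₀} ν′_w∕t_w) ) d(ν′_{w₀}∕t_{w₀})`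
(§1 with its `Integrable` binder discharged by ★ (A1) `integrable_comp_symm_archPiEquivCM_descConj_pi_of_regG`).
[cite: Rogawski1990, §8.2 p. 122; §8.3 pp. 122–124] [cite: Folland1995, §2.6 (2.52)] [cite: DeitmarEchterhoff2014, Lemma 9.3.3] -/
theorem chartOrbG_eq_prod_mul_integral_integral_isolate_of_regG (hα : ∀ i, α i ≠ 0) (hS' : ∀ w, w ∈ S' → w ∈ splitChartPlaces L α)
    (w₀ : {w : InfinitePlace L // IsComplex w})
    {c : {w : InfinitePlace L // IsComplex w} → Fin 3 → ℝ} (hc : c ∈ ArchCartan.RegG S')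
    {a' : ↥(arch (↥(maximalRealSubfield L)) L (IsCMField.complexConj L) 3 (Matrix.diagonal α)) → ℂ} (ha'c : Continuous a') (ha's : HasCompactSupport a') :
    chartOrbG L α ν' S' a' c =
      (∏ w, ((t w (chartBoxImgGLoc L α w S')).toReal : ℂ)) *
        ∫ y : ↥(archLocal L 3 (Matrix.diagonal α) w₀) ⧸ chartTorusGLoc L α w₀ S',
          (∫ b : (∀ w' : {w : {w : InfinitePlace L // IsComplex w} // ¬ w = w₀}, ↥(archLocal L 3 (Matrix.diagonal α) w'.1) ⧸ chartTorusGLoc L α w'.1 S'),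
            a' ((archPiEquivCM 3 L (Matrix.diagonal α)).symm fun w =>
              descConj (gprimeBlockAt L α w S' (c w)) (chartTorusGLoc L α w S') (forall_mem_chartTorusGLoc_comm L α w S' (c w)) id
                ((MeasurableEquiv.piEquivPiSubtypeProd
                    (fun w : {w : InfinitePlace L // IsComplex w} => ↥(archLocal L 3 (Matrix.diagonal α) w) ⧸ chartTorusGLoc L α w S') (· = w₀)).symm
                  ((MeasurableEquiv.piUnique fun i : {w : {w : InfinitePlace L // IsComplex w} // w = w₀} =>
                      ↥(archLocal L 3 (Matrix.diagonal α) i.1) ⧸ chartTorusGLoc L α i.1 S').symm y, b) w))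
            ∂(Measure.pi fun w' : {w : {w : InfinitePlace L // IsComplex w} // ¬ w = w₀} =>
                quotientMeasure (chartTorusGLoc L α w'.1 S') (t w'.1) (isClosed_chartTorusGLoc L α w'.1 S') (ν'w w'.1)))
          ∂(quotientMeasure (chartTorusGLoc L α w₀ S') (t w₀) (isClosed_chartTorusGLoc L α w₀ S') (ν'w w₀)) :=
  chartOrbG_eq_prod_mul_integral_integral_isolate L α S' ν'w ν' hν t hα hS' w₀
    (integrable_comp_symm_archPiEquivCM_descConj_pi_of_regG L α S' ν'w ν' hν t hα hS' hc ha'c ha's)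

/-! ## §2 The group form at a COMPACT-chart place `w₀ ∉ S′`: a whole-group orbital integral of the partial chart-orbital integral -/

/-- The inverse of Mathlib's `piEquivPiSubtypeProd`, read componentwise (definitional; as in ★ `ArchTorusOrbitalFubini` §4). [cite: BorelJacquet1979, §4.1] -/
private theorem piEquivPiSubtypeProd_symm_apply_dite' {ι : Type*} (π : ι → Type*) [∀ i, MeasurableSpace (π i)] (p : ι → Prop)
    [DecidablePred p] (a : ∀ i : Subtype p, π i) (b : ∀ i : {i // ¬ p i}, π i) (i : ι) :
    (MeasurableEquiv.piEquivPiSubtypeProd π p).symm (a, b) i = if h : p i then a ⟨i, h⟩ else b ⟨i, h⟩ := rfl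

/-- The inverse of Mathlib's `piUnique` over the singleton `{w ∣ w = w₀}`, read at `w₀` (as in ★ `ArchTorusOrbitalFubini` §4). [cite: BorelJacquet1979, §4.1] -/
private theorem piUnique_symm_apply_of_eq' {ι : Type*} (π : ι → Type*) [∀ i, MeasurableSpace (π i)] (i₀ : ι) (x : π i₀) (h : i₀ = i₀) :
    (MeasurableEquiv.piUnique fun i : {i // i = i₀} => π i.1).symm x ⟨i₀, h⟩ = x :=
  uniqueElim_default (α := fun i : {i // i = i₀} => π i.1) x

omit [∀ w : {w : InfinitePlace L // IsComplex w}, BorelSpace ↥(archLocal L 3 (Matrix.diagonal α) w)]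
  [∀ w : {w : InfinitePlace L // IsComplex w}, LocallyCompactSpace ↥(archLocal L 3 (Matrix.diagonal α) w)]
  [∀ w : {w : InfinitePlace L // IsComplex w}, SecondCountableTopology ↥(archLocal L 3 (Matrix.diagonal α) w)]
  [∀ w : {w : InfinitePlace L // IsComplex w}, BorelSpace (↥(archLocal L 3 (Matrix.diagonal α) w) ⧸ chartTorusGLoc L α w S')]
  [MeasurableSpace ↥(arch (↥(maximalRealSubfield L)) L (IsCMField.complexConj L) 3 (Matrix.diagonal α))]
  [BorelSpace ↥(arch (↥(maximalRealSubfield L)) L (IsCMField.complexConj L) 3 (Matrix.diagonal α))] in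
/-- **REASSEMBLY THROUGH `descConj … id`**: conjugating the assembled QUOTIENT family `(y, b)` place by place by the base points `γ_w(c)` gives the assembled GROUP family of the
conjugated pieces `(ẏ γ_{w₀}(c) ẏ⁻¹, (ḃ_{w′} γ_{w′}(c) ḃ_{w′}⁻¹)_{w′ ≠ w₀})` (the assembly = Mathlib `piEquivPiSubtypeProd (· = w₀)` + `piUnique` on the groups `U(α)_w`).
[cite: BorelJacquet1979, §4.1] [cite: Rogawski1990, §8.2 p. 122] -/
theorem descConj_assembleQuotient_eq (w₀ : {w : InfinitePlace L // IsComplex w}) (c : {w : InfinitePlace L // IsComplex w} → Fin 3 → ℝ)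
    (y : ↥(archLocal L 3 (Matrix.diagonal α) w₀) ⧸ chartTorusGLoc L α w₀ S')
    (b : ∀ w' : {w : {w : InfinitePlace L // IsComplex w} // ¬ w = w₀}, ↥(archLocal L 3 (Matrix.diagonal α) w'.1) ⧸ chartTorusGLoc L α w'.1 S') :
    (fun w => descConj (gprimeBlockAt L α w S' (c w)) (chartTorusGLoc L α w S') (forall_mem_chartTorusGLoc_comm L α w S' (c w)) id
        ((MeasurableEquiv.piEquivPiSubtypeProd
            (fun w : {w : InfinitePlace L // IsComplex w} => ↥(archLocal L 3 (Matrix.diagonal α) w) ⧸ chartTorusGLoc L α w S') (· = w₀)).symm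
          ((MeasurableEquiv.piUnique fun i : {w : {w : InfinitePlace L // IsComplex w} // w = w₀} =>
              ↥(archLocal L 3 (Matrix.diagonal α) i.1) ⧸ chartTorusGLoc L α i.1 S').symm y, b) w)) =
      (MeasurableEquiv.piEquivPiSubtypeProd (fun w : {w : InfinitePlace L // IsComplex w} => ↥(archLocal L 3 (Matrix.diagonal α) w)) (· = w₀)).symm
        ((MeasurableEquiv.piUnique fun i : {w : {w : InfinitePlace L // IsComplex w} // w = w₀} => ↥(archLocal L 3 (Matrix.diagonal α) i.1)).symm
            (descConj (gprimeBlockAt L α w₀ S' (c w₀)) (chartTorusGLoc L α w₀ S') (forall_mem_chartTorusGLoc_comm L α w₀ S' (c w₀)) id y),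
          fun w' => descConj (gprimeBlockAt L α w'.1 S' (c w'.1)) (chartTorusGLoc L α w'.1 S') (forall_mem_chartTorusGLoc_comm L α w'.1 S' (c w'.1)) id (b w')) := by
  funext w
  rw [piEquivPiSubtypeProd_symm_apply_dite', piEquivPiSubtypeProd_symm_apply_dite']
  by_cases h : w = w₀
  · subst h
    rw [dif_pos rfl, dif_pos rfl]
    erw [piUnique_symm_apply_of_eq' (fun j : {w : InfinitePlace L // IsComplex w} => ↥(archLocal L 3 (Matrix.diagonal α) j) ⧸ chartTorusGLoc L α j S') w y,
      piUnique_symm_apply_of_eq' (fun j : {w : InfinitePlace L // IsComplex w} => ↥(archLocal L 3 (Matrix.diagonal α) j)) w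
        (descConj (gprimeBlockAt L α w S' (c w)) (chartTorusGLoc L α w S') (forall_mem_chartTorusGLoc_comm L α w S' (c w)) id y)]
  · rw [dif_neg h, dif_neg h]

include hν in
/-- **(J-iso), GROUP FORM AT A COMPACT PLACE — THE `w₀`-PLACE IS A WHOLE-GROUP ORBITAL INTEGRAL OF THE PARTIAL CHART-ORBITAL INTEGRAL OVER THE OTHER PLACES.**
For admissible `S′`, a compact-chart place `w₀ ∉ S′` (so `T′_{S′,w₀}` is compact, ★ `compactSpace_chartTorusGLoc_of_not_mem`), `c ∈ RegG S′` and `a′ ∈ C_c(G′_∞)`: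
`chartOrbG ν′ S′ a′ c = (Π_{w≠w₀} t_w(B′_w)) · ∫_{U(α)_{w₀}} Θ_c(g · γ_{w₀}(c) · g⁻¹) dν′_{w₀}(g)`, where
`Θ_c(x) = ∫_{Π_{w≠w₀}(U_w⧸T′_w)} a′ (e⁻¹ (x, (ḃ_w γ_w(c) ḃ_w⁻¹)_{w≠w₀})) d(⊗_{w≠w₀} ν′_w∕t_w)` is the partial chart-orbital integral over the other places read at the group
element `x ∈ U(α)_{w₀}` (the lambda below; assembly by `piEquivPiSubtypeProd (· = w₀)` + `piUnique` on the groups).  The `w₀`-torus measure `t_{w₀}` is GONE: its box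
factor `t_{w₀}(B′_{w₀}) = t_{w₀}(T′)` (★ `chartBoxImgGLoc_eq_univ_of_not_mem`) cancels the `t_{w₀}(T′)⁻¹` of ★ `integral_quotientMeasure_eq_inv_smul`.  (Measurability of `Θ_c`:
Mathlib `StronglyMeasurable.integral_prod_right'` on the continuous integrand.) [cite: Folland1995, §2.6 Thm. 2.49, (2.52)] [cite: Rogawski1990, §8.2 p. 122; §8.3 p. 124]
[cite: DeitmarEchterhoff2014, Cor. 1.5.4; Lemma 9.3.3] [cite: BorelJacquet1979, §4.1] -/
theorem chartOrbG_eq_prod_mul_integral_group_isolate_of_not_mem (hα : ∀ i, α i ≠ 0) (hS' : ∀ w, w ∈ S' → w ∈ splitChartPlaces L α)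
    {w₀ : {w : InfinitePlace L // IsComplex w}} (hw₀ : w₀ ∉ S')
    {c : {w : InfinitePlace L // IsComplex w} → Fin 3 → ℝ} (hc : c ∈ ArchCartan.RegG S')
    {a' : ↥(arch (↥(maximalRealSubfield L)) L (IsCMField.complexConj L) 3 (Matrix.diagonal α)) → ℂ} (ha'c : Continuous a') (ha's : HasCompactSupport a') :
    chartOrbG L α ν' S' a' c =
      (∏ w' : {w : {w : InfinitePlace L // IsComplex w} // ¬ w = w₀}, ((t w'.1 (chartBoxImgGLoc L α w'.1 S')).toReal : ℂ)) *
        ∫ g : ↥(archLocal L 3 (Matrix.diagonal α) w₀),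
          (∫ b : (∀ w' : {w : {w : InfinitePlace L // IsComplex w} // ¬ w = w₀}, ↥(archLocal L 3 (Matrix.diagonal α) w'.1) ⧸ chartTorusGLoc L α w'.1 S'),
            a' ((archPiEquivCM 3 L (Matrix.diagonal α)).symm
              ((MeasurableEquiv.piEquivPiSubtypeProd (fun w : {w : InfinitePlace L // IsComplex w} => ↥(archLocal L 3 (Matrix.diagonal α) w)) (· = w₀)).symm
                ((MeasurableEquiv.piUnique fun i : {w : {w : InfinitePlace L // IsComplex w} // w = w₀} => ↥(archLocal L 3 (Matrix.diagonal α) i.1)).symm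
                    (g * gprimeBlockAt L α w₀ S' (c w₀) * g⁻¹),
                  fun w' => descConj (gprimeBlockAt L α w'.1 S' (c w'.1)) (chartTorusGLoc L α w'.1 S') (forall_mem_chartTorusGLoc_comm L α w'.1 S' (c w'.1)) id (b w'))))
            ∂(Measure.pi fun w' : {w : {w : InfinitePlace L // IsComplex w} // ¬ w = w₀} =>
                quotientMeasure (chartTorusGLoc L α w'.1 S') (t w'.1) (isClosed_chartTorusGLoc L α w'.1 S') (ν'w w'.1)))
          ∂(ν'w w₀) := by
  haveI : ∀ w : {w : InfinitePlace L // IsComplex w}, IsClosed (chartTorusGLoc L α w S' : Set ↥(archLocal L 3 (Matrix.diagonal α) w)) :=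
    fun w => isClosed_chartTorusGLoc L α w S'
  haveI : ∀ w : {w : InfinitePlace L // IsComplex w}, SecondCountableTopology (↥(archLocal L 3 (Matrix.diagonal α) w) ⧸ chartTorusGLoc L α w S') := fun w => inferInstance
  haveI : ∀ w : {w : InfinitePlace L // IsComplex w},
      SigmaFinite (quotientMeasure (chartTorusGLoc L α w S') (t w) (isClosed_chartTorusGLoc L α w S') (ν'w w)) := fun w => inferInstance
  haveI : ∀ w, LocallyCompactSpace ↥(chartTorusGLoc L α w S') := fun w => locallyCompactSpace_chartTorusGLoc L α w S'
  haveI : ∀ w, SecondCountableTopology ↥(chartTorusGLoc L α w S') := fun w => TopologicalSpace.Subtype.secondCountableTopology _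
  haveI : ∀ w, SigmaFinite (t w) := fun w => inferInstance
  haveI := compactSpace_chartTorusGLoc_of_not_mem L α w₀ S' hα hS' hw₀
  rw [chartOrbG_eq_prod_mul_integral_integral_isolate_of_regG L α S' ν'w ν' hν t hα hS' w₀ hc ha'c ha's]
  -- the partial chart-orbital integral over the places `w′ ≠ w₀`, as a function on the GROUP `U(α)_{w₀}`
  set Θ : ↥(archLocal L 3 (Matrix.diagonal α) w₀) → ℂ := fun x =>
    ∫ b : (∀ w' : {w : {w : InfinitePlace L // IsComplex w} // ¬ w = w₀}, ↥(archLocal L 3 (Matrix.diagonal α) w'.1) ⧸ chartTorusGLoc L α w'.1 S'),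
      a' ((archPiEquivCM 3 L (Matrix.diagonal α)).symm
        ((MeasurableEquiv.piEquivPiSubtypeProd (fun w : {w : InfinitePlace L // IsComplex w} => ↥(archLocal L 3 (Matrix.diagonal α) w)) (· = w₀)).symm
          ((MeasurableEquiv.piUnique fun i : {w : {w : InfinitePlace L // IsComplex w} // w = w₀} => ↥(archLocal L 3 (Matrix.diagonal α) i.1)).symm x,
            fun w' => descConj (gprimeBlockAt L α w'.1 S' (c w'.1)) (chartTorusGLoc L α w'.1 S') (forall_mem_chartTorusGLoc_comm L α w'.1 S' (c w'.1)) id (b w'))))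
      ∂(Measure.pi fun w' : {w : {w : InfinitePlace L // IsComplex w} // ¬ w = w₀} =>
          quotientMeasure (chartTorusGLoc L α w'.1 S') (t w'.1) (isClosed_chartTorusGLoc L α w'.1 S') (ν'w w'.1)) with hΘ
  -- the outer integrand of §1 is `descConj (γ_{w₀}(c)) T′_{w₀} _ Θ`
  have hout : (fun y : ↥(archLocal L 3 (Matrix.diagonal α) w₀) ⧸ chartTorusGLoc L α w₀ S' =>
      ∫ b : (∀ w' : {w : {w : InfinitePlace L // IsComplex w} // ¬ w = w₀}, ↥(archLocal L 3 (Matrix.diagonal α) w'.1) ⧸ chartTorusGLoc L α w'.1 S'),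
        a' ((archPiEquivCM 3 L (Matrix.diagonal α)).symm fun w =>
          descConj (gprimeBlockAt L α w S' (c w)) (chartTorusGLoc L α w S') (forall_mem_chartTorusGLoc_comm L α w S' (c w)) id
            ((MeasurableEquiv.piEquivPiSubtypeProd
                (fun w : {w : InfinitePlace L // IsComplex w} => ↥(archLocal L 3 (Matrix.diagonal α) w) ⧸ chartTorusGLoc L α w S') (· = w₀)).symm
              ((MeasurableEquiv.piUnique fun i : {w : {w : InfinitePlace L // IsComplex w} // w = w₀} =>
                  ↥(archLocal L 3 (Matrix.diagonal α) i.1) ⧸ chartTorusGLoc L α i.1 S').symm y, b) w))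
        ∂(Measure.pi fun w' : {w : {w : InfinitePlace L // IsComplex w} // ¬ w = w₀} =>
            quotientMeasure (chartTorusGLoc L α w'.1 S') (t w'.1) (isClosed_chartTorusGLoc L α w'.1 S') (ν'w w'.1))) =
      descConj (gprimeBlockAt L α w₀ S' (c w₀)) (chartTorusGLoc L α w₀ S') (forall_mem_chartTorusGLoc_comm L α w₀ S' (c w₀)) Θ := by
    funext y
    rw [descConj_eq_comp (gprimeBlockAt L α w₀ S' (c w₀)) (chartTorusGLoc L α w₀ S') (forall_mem_chartTorusGLoc_comm L α w₀ S' (c w₀)) Θ,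
      Function.comp_apply, hΘ]
    refine integral_congr_ae (Filter.Eventually.of_forall fun b => ?_)
    simp only []
    rw [descConj_assembleQuotient_eq L α S' w₀ c y b]
  rw [hout]
  -- `Θ` is Borel: it is the partial integral of a CONTINUOUS integrand on `U(α)_{w₀} × Π_{w′≠w₀} (U_{w′} ⧸ T′_{w′})`
  have hΘm : Measurable Θ := by
    have hcont : Continuous fun p : ↥(archLocal L 3 (Matrix.diagonal α) w₀) ×
        (∀ w' : {w : {w : InfinitePlace L // IsComplex w} // ¬ w = w₀}, ↥(archLocal L 3 (Matrix.diagonal α) w'.1) ⧸ chartTorusGLoc L α w'.1 S') =>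
        a' ((archPiEquivCM 3 L (Matrix.diagonal α)).symm
          ((MeasurableEquiv.piEquivPiSubtypeProd (fun w : {w : InfinitePlace L // IsComplex w} => ↥(archLocal L 3 (Matrix.diagonal α) w)) (· = w₀)).symm
            ((MeasurableEquiv.piUnique fun i : {w : {w : InfinitePlace L // IsComplex w} // w = w₀} => ↥(archLocal L 3 (Matrix.diagonal α) i.1)).symm p.1,
              fun w' => descConj (gprimeBlockAt L α w'.1 S' (c w'.1)) (chartTorusGLoc L α w'.1 S') (forall_mem_chartTorusGLoc_comm L α w'.1 S' (c w'.1)) id (p.2 w')))) := by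
      refine ha'c.comp ((archPiEquivCM 3 L (Matrix.diagonal α)).symm.continuous.comp ?_)
      have hsymm : Continuous (MeasurableEquiv.piEquivPiSubtypeProd
          (fun w : {w : InfinitePlace L // IsComplex w} => ↥(archLocal L 3 (Matrix.diagonal α) w)) (· = w₀)).symm :=
        (Homeomorph.piEquivPiSubtypeProd (· = w₀) (fun w : {w : InfinitePlace L // IsComplex w} => ↥(archLocal L 3 (Matrix.diagonal α) w))).symm.continuous
      have huniq : Continuous (MeasurableEquiv.piUnique fun i : {w : {w : InfinitePlace L // IsComplex w} // w = w₀} =>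
          ↥(archLocal L 3 (Matrix.diagonal α) i.1)).symm :=
        (Homeomorph.piUnique fun i : {w : {w : InfinitePlace L // IsComplex w} // w = w₀} => ↥(archLocal L 3 (Matrix.diagonal α) i.1)).symm.continuous
      refine hsymm.comp ((huniq.comp continuous_fst).prodMk (continuous_pi fun w' => ?_))
      exact (continuous_descConj (gprimeBlockAt L α w'.1 S' (c w'.1)) (chartTorusGLoc L α w'.1 S') (forall_mem_chartTorusGLoc_comm L α w'.1 S' (c w'.1))
        continuous_id).comp ((continuous_apply w').comp continuous_snd)
    exact hcont.stronglyMeasurable.integral_prod_right'.measurable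
  rw [integral_quotientMeasure_eq_inv_smul (chartTorusGLoc L α w₀ S') (t w₀) (ν'w w₀) _
      (measurable_descConj (gprimeBlockAt L α w₀ S' (c w₀)) (chartTorusGLoc L α w₀ S') (forall_mem_chartTorusGLoc_comm L α w₀ S' (c w₀)) hΘm).stronglyMeasurable]
  simp only [descConj_mk]
  -- constants: `Π_w t_w(B′_w) = t_{w₀}(B′_{w₀}) · Π_{w≠w₀} t_w(B′_w)`, `B′_{w₀} = T′_{w₀}` (whole torus at `w₀ ∉ S′`), cancel against `t_{w₀}(T′)⁻¹`
  have hsplit : (∏ w, ((t w (chartBoxImgGLoc L α w S')).toReal : ℂ)) =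
      ((t w₀ (chartBoxImgGLoc L α w₀ S')).toReal : ℂ) * ∏ w' : {w : {w : InfinitePlace L // IsComplex w} // ¬ w = w₀}, ((t w'.1 (chartBoxImgGLoc L α w'.1 S')).toReal : ℂ) := by
    rw [← Fintype.prod_subtype_mul_prod_subtype (fun w => w = w₀) (fun w => ((t w (chartBoxImgGLoc L α w S')).toReal : ℂ))]
    congr 1
    convert Fintype.prod_subsingleton (fun w : {w : {w : InfinitePlace L // IsComplex w} // w = w₀} => ((t w.1 (chartBoxImgGLoc L α w.1 S')).toReal : ℂ)) ⟨w₀, rfl⟩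
  have hpos : (t w₀ Set.univ).toReal ≠ 0 :=
    (ENNReal.toReal_pos (isOpen_univ.measure_pos (t w₀) Set.univ_nonempty).ne' (isCompact_univ.measure_lt_top).ne).ne'
  rw [hsplit, chartBoxImgGLoc_eq_univ_of_not_mem L α w₀ S' hα hS' hw₀, measureReal_def, Complex.real_smul, Complex.ofReal_inv, mul_assoc,
    mul_left_comm (((t w₀ Set.univ).toReal : ℂ)), ← mul_assoc (((t w₀ Set.univ).toReal : ℂ)), mul_inv_cancel₀ (Complex.ofReal_ne_zero.mpr hpos), one_mul]

end Isolate

end Literature.NumberTheory.Automorphic.UnitaryGroup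

end
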